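import Summits.QuantumFields.BalabanUV.T4Continuum.Support.ShellMeasureCommutatorVariation
import Summits.QuantumFields.BalabanUV.T4Continuum.Support.ShellMeasureLocalGradientTail

/-!
# `T4Continuum.ShellMeasureCommutatorLocGrad` — row S65 f5 (junction J2, part a): leaf-05's CUBIC COMMUTATOR FUNCTIONAL
# (the `∇`-part of (P4)) IN FINITE VOLUME as a differentiable functional of the bond field, and ITS BOND-LOCAL GRADIENT
# `locGrad` (S62) = leaf-05's FIRST VARIATION `dcub(·)[ι_bX]` summed over the plaquettes
# (cell `pub-balaban`, sub-cell `t4`, spine estimate NE7c (node U5b), crew lineage `b2b-balaban-t4-ne7c-formalise-leaf-02`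
# gen 8, owner table `LEAVES-NE7c-P1.md` row S65; imports leaf-05-g7's S65 f3a `ShellMeasureCommutatorVariation` (p222184)
# and the owner's S62 f1 `ShellMeasureLocalGradientTail` ONLY; [folklore]; 0 sorry)

HONEST FRAMING.  Finite four-torus programme, rung (B)+1 only — NOT infinite volume, NOT a mass gap, NOT the Clay
problem, NOT summit progress; (B), `BetaPertHyp`, (B^μ) are not consumed.  NE7c (`T4IndicatorShell.ShellWeightBound`)
is NOT PRINTED and NOT PROVED; «NE7c ⇐ the named binders» (WALL `t4/b2b-balaban-t4-ne7c-p1/WALL-NE7c-P1.md` §2).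
ELEMENTARY calculus on a normed `ℂ`-algebra ([folklore]); [Balaban1985Variational] (39)∕(90)–(96) are LOCATORS for the
shape only — the paper is under adjudication; nothing printed is asserted or cited as a fact; no `def … : Prop` is
minted (the `def`s are DATA: extension by zero, the finite-volume functional).  HONEST DEPENDENCY (cell): continuum YM
on T⁴ ⇐ BetaPertH ∧ nine spine estimates (0/9 proved); BetaPertH ⇐ (D1) ∧ (D4) ∧ CAP+tail; G-an2-4 gates asym, D1 and
NE2/3/4.

THE POINT (locator `HOME/b2b-balaban-t4-ne7c-formalise-leaf-02/XREAD-P4-B11-SectB.md` §3 (j)–(k), §4; holder's GO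
l.15529).  Row S65 types (P4) = END-II's `hW : ∀ V, Prop4Hyp (W𝒱 V) C₄ a₃` at the live levels.  Its `∇`-part — the
first term of (39), whose multi-scale gain is the summation by parts (93) + [6] (1.52) — is typed by leaf-05-g7 on b08's
INFINITE lattice `Site d = Fin d → ℤ` as the density `cub w τ η U₀ B μ ν x` with first variation `dcub` along lines
(`hasDerivAt_sum_cub`, no norm on the field space).  END-II and the (98) packaging of this lineage (`WSup`, `WMax`,
`Prop4Hyp`) live on FINITE bond sets with S62's Fréchet `locGrad`.  THIS FILE is the typing junction between the two:
* §1 `ext Λ A` — extension by zero of a field `A : ↥Λ → 𝔸` on a FINITE bond set `Λ ⊂ Site d × Fin d` to b08's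
  `Site d → Fin d → 𝔸`; linear (`ext_add`, `ext_smul`, `ext_add_smul`), each value a continuous linear function of `A`
  (`differentiable_ext_apply`), and **`ext_single`**: `ext Λ (Pi.single b X) = bump b.1.1 b.1.2 X` (S62's single-bond
  direction IS leaf-05's `bump`);
* §2 `cubT Λ Pl w τ η U₀ : (↥Λ → 𝔸) → ℂ`, `A ↦ Σ_{p∈Pl} cub w τ η U₀ (ext Λ A) p` — the finite-volume cubic commutator
  functional; **`differentiable_cubT`** (a continuous cubic polynomial in the bond variables: unfolded to b08's
  `X1…X4`, `conjR`, `adR`, `lin`, `plaqCovDeriv`, `brk` and closed under `Differentiable.mul/add/sub/smul`);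
* §3 **`locGrad_cubT_apply`**: `locGrad (cubT …) A b X = Σ_{p∈Pl} dcub w τ η U₀ (ext Λ A) (bump b.1.1 b.1.2 X) p` —
  S62's bond-local gradient of the finite-volume functional IS leaf-05's first variation in the single-bond direction
  (chain rule along the line `t ↦ A + t·ι_bX` + `hasDerivAt_sum_cub` + uniqueness of derivatives).
So when leaf-05's f3c bounds `|Σ_p dcub(B)[ι_bX](p)|` by `O(d)·|w|·‖τ‖·a·G·‖X‖` with LOCALISED `a`, `G` (holder's NOTE
l.15673), the bound is a bound on `‖locGrad (cubT …) A b‖` and enters `WMax`'s (98) by `Prop4Hyp.add` (f2c) — part b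
of J2, after f3c.  NOT HERE: any estimate (f3c's), the weighted packaging (f2a∕f2c), the identification with the actual
one-grid action's `ord₃` (S65 f4, leaf-03), the HD-dressing (S66), [dict] (node O).  Typing only; no estimate of
Bałaban's is discharged.
-/

noncomputable section

open scoped BigOperators

namespace Summit.QuantumFields.BalabanUV.T4Continuum.ShellMeasureCommutatorLocGrad

open Literature.MathematicalPhysics.QuantumFieldTheory.Balaban1983to89
open B7Prop1Explicit (e)
open B7Eq78Linearization (conjR conjR_apply)
open B8Eq146AExpansion (X1 X2 X3 X4 lin adR plaqCovDeriv)
open B8Eq151V2Divergence (brk)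
open Summit.QuantumFields.BalabanUV.T4Continuum.ShellMeasureCommutatorVariation
  (bump dbrk cub dcub hasDerivAt_sum_cub)
open Summit.QuantumFields.BalabanUV.T4Continuum.ShellMeasureLocalGradientTail (sgl sgl_apply locGrad locGrad_apply_apply)

export B7Prop1Explicit (Site)

variable {d : ℕ} {𝔸 : Type*} [NormedRing 𝔸] [NormedAlgebra ℂ 𝔸]

/-! ## §1 Finite volume: extension by zero from a finite bond set -/

/-- EXTENSION BY ZERO of a field on the finite bond set `Λ ⊂ Site d × Fin d` (a bond = (site, direction)) to b08's
bond fields on the infinite lattice. [folklore] -/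
def ext (Λ : Finset (Site d × Fin d)) (A : ↥Λ → 𝔸) : Site d → Fin d → 𝔸 :=
  fun x μ => if h : (x, μ) ∈ Λ then A ⟨(x, μ), h⟩ else 0

variable (Λ : Finset (Site d × Fin d))

omit [NormedAlgebra ℂ 𝔸] in
/-- On a bond of `Λ` the extension is the field. [folklore] -/
theorem ext_apply_of_mem (A : ↥Λ → 𝔸) {x : Site d} {μ : Fin d} (h : (x, μ) ∈ Λ) :
    ext Λ A x μ = A ⟨(x, μ), h⟩ := by
  simp [ext, h]

omit [NormedAlgebra ℂ 𝔸] in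
/-- Off `Λ` the extension vanishes. [folklore] -/
theorem ext_apply_of_not_mem (A : ↥Λ → 𝔸) {x : Site d} {μ : Fin d} (h : (x, μ) ∉ Λ) : ext Λ A x μ = 0 := by
  simp [ext, h]

omit [NormedAlgebra ℂ 𝔸] in
/-- `ext` is additive. [folklore] -/
theorem ext_add (A B : ↥Λ → 𝔸) : ext Λ (A + B) = ext Λ A + ext Λ B := by
  funext x μ
  by_cases h : (x, μ) ∈ Λ
  · simp [ext, h]
  · simp [ext, h]

/-- `ext` is homogeneous. [folklore] -/
theorem ext_smul (c : ℂ) (A : ↥Λ → 𝔸) : ext Λ (c • A) = c • ext Λ A := by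
  funext x μ
  by_cases h : (x, μ) ∈ Λ
  · simp [ext, h]
  · simp [ext, h]

/-- The line `A + tH` extends to the line `ext A + t·ext H` (the shape `hasDerivAt_sum_cub` takes). [folklore] -/
theorem ext_add_smul (A H : ↥Λ → 𝔸) (t : ℂ) : ext Λ (A + t • H) = ext Λ A + t • ext Λ H := by
  rw [ext_add, ext_smul]

omit [NormedAlgebra ℂ 𝔸] in
/-- **S62's single-bond direction IS leaf-05's `bump`**: `ext Λ (Pi.single b X) = bump b.1.1 b.1.2 X`. [folklore] -/
theorem ext_single (b : ↥Λ) (X : 𝔸) : ext Λ (Pi.single b X) = bump b.1.1 b.1.2 X := by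
  funext x μ
  by_cases h : (x, μ) ∈ Λ
  · rw [ext_apply_of_mem Λ _ h]
    by_cases hb : (⟨(x, μ), h⟩ : ↥Λ) = b
    · subst hb
      simp [bump]
    · have hne : ¬(x = b.1.1 ∧ μ = b.1.2) := by
        rintro ⟨rfl, rfl⟩
        exact hb (Subtype.ext rfl)
      rw [Pi.single_eq_of_ne hb]
      simp [bump, hne]
  · rw [ext_apply_of_not_mem Λ _ h]
    have hne : ¬(x = b.1.1 ∧ μ = b.1.2) := by
      rintro ⟨rfl, rfl⟩
      exact h (by simp)
    simp [bump, hne]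

/-- Each value `A ↦ ext Λ A x μ` is a continuous linear (hence differentiable) function of the field: a coordinate
projection on `Λ`, zero off `Λ`. [folklore] -/
theorem differentiable_ext_apply (x : Site d) (μ : Fin d) : Differentiable ℂ fun A : ↥Λ → 𝔸 => ext Λ A x μ := by
  by_cases h : (x, μ) ∈ Λ
  · have hf : (fun A : ↥Λ → 𝔸 => ext Λ A x μ) = fun A => A ⟨(x, μ), h⟩ := by
      funext A
      exact ext_apply_of_mem Λ A h
    rw [hf]
    exact (ContinuousLinearMap.proj (R := ℂ) (φ := fun _ : ↥Λ => 𝔸) ⟨(x, μ), h⟩).differentiable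
  · have hf : (fun A : ↥Λ → 𝔸 => ext Λ A x μ) = fun _ => 0 := by
      funext A
      exact ext_apply_of_not_mem Λ A h
    rw [hf]
    exact differentiable_const 0

/-! ## §2 The finite-volume cubic commutator functional and its differentiability -/

section Functional

variable (Pl : Finset (Fin d × Fin d × Site d)) (w : ℂ) (τ : 𝔸 →L[ℂ] ℂ) (η : ℝ) (U₀ : Site d → Fin d → 𝔸ˣ)

/-- THE FINITE-VOLUME CUBIC COMMUTATOR FUNCTIONAL `A ↦ Σ_{p∈Pl} w·τ((D^η_{U₀}(ext A))(p)·{…}_{ext A}(p))` — leaf-05's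
density `cub` summed over a finite plaquette set, as a function of the field on the finite bond set `Λ` (the SHAPE of
the first term of [Balaban1985Variational] (39) summed over plaquettes; locator only). [folklore] -/
def cubT : (↥Λ → 𝔸) → ℂ := fun A => ∑ p ∈ Pl, cub w τ η U₀ (ext Λ A) p.1 p.2.1 p.2.2

/-- Unfolding. [folklore] -/
theorem cubT_apply (A : ↥Λ → 𝔸) :
    cubT Λ Pl w τ η U₀ A = ∑ p ∈ Pl, cub w τ η U₀ (ext Λ A) p.1 p.2.1 p.2.2 := rfl

/-- Conjugation by a fixed unit preserves differentiability. [folklore] -/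
theorem differentiable_conjR (u : 𝔸ˣ) {f : (↥Λ → 𝔸) → 𝔸} (hf : Differentiable ℂ f) :
    Differentiable ℂ fun A => conjR u (f A) := by
  have h : (fun A => conjR u (f A)) = fun A => (u : 𝔸) * f A * ((u⁻¹ : 𝔸ˣ) : 𝔸) := by
    funext A
    exact conjR_apply u (f A)
  rw [h]
  exact ((differentiable_const _).mul hf).mul (differentiable_const _)

/-- The commutator of differentiable maps is differentiable. [folklore] -/
theorem differentiable_adR {f g : (↥Λ → 𝔸) → 𝔸} (hf : Differentiable ℂ f) (hg : Differentiable ℂ g) :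
    Differentiable ℂ fun A => adR (f A) (g A) := by
  unfold adR
  exact (hf.mul hg).sub (hg.mul hf)

/-- The four transported plaquette variables of the extended field are differentiable in the field. [folklore] -/
theorem differentiable_X1 (μ : Fin d) (x : Site d) : Differentiable ℂ fun A : ↥Λ → 𝔸 => X1 (ext Λ A) μ x :=
  differentiable_ext_apply Λ x μ

/-- (see `differentiable_X1`). [folklore] -/
theorem differentiable_X2 (μ ν : Fin d) (x : Site d) : Differentiable ℂ fun A : ↥Λ → 𝔸 => X2 U₀ (ext Λ A) μ ν x :=
  differentiable_conjR Λ (U₀ x μ) (differentiable_ext_apply Λ (x + e μ) ν)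

/-- (see `differentiable_X1`). [folklore] -/
theorem differentiable_X3 (μ ν : Fin d) (x : Site d) : Differentiable ℂ fun A : ↥Λ → 𝔸 => X3 U₀ (ext Λ A) μ ν x :=
  differentiable_conjR Λ (U₀ x ν) (differentiable_ext_apply Λ (x + e ν) μ).neg

/-- (see `differentiable_X1`). [folklore] -/
theorem differentiable_X4 (ν : Fin d) (x : Site d) : Differentiable ℂ fun A : ↥Λ → 𝔸 => X4 (ext Λ A) ν x :=
  (differentiable_ext_apply Λ x ν).neg

/-- The plaquette covariant derivative of the extended field is differentiable in the field. [folklore] -/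
theorem differentiable_plaqCovDeriv (μ ν : Fin d) (x : Site d) :
    Differentiable ℂ fun A : ↥Λ → 𝔸 => plaqCovDeriv η U₀ (ext Λ A) μ ν x := by
  unfold plaqCovDeriv lin
  exact ((((differentiable_X1 Λ μ x).add (differentiable_X2 Λ U₀ μ ν x)).add (differentiable_X3 Λ U₀ μ ν x)).add
    (differentiable_X4 Λ ν x)).const_smul _

/-- b08's bracket `{…}` of the extended field is differentiable in the field. [folklore] -/
theorem differentiable_brk (μ ν : Fin d) (x : Site d) :
    Differentiable ℂ fun A : ↥Λ → 𝔸 => brk U₀ (ext Λ A) μ ν x := by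
  have h1 := differentiable_X1 (𝔸 := 𝔸) Λ μ x
  have h2 := differentiable_X2 Λ U₀ μ ν x
  have h3 := differentiable_X3 Λ U₀ μ ν x
  have h4 := differentiable_X4 (𝔸 := 𝔸) Λ ν x
  unfold brk
  exact (((((differentiable_adR Λ h1 h2).add (differentiable_adR Λ h1 h3)).add (differentiable_adR Λ h1 h4)).add
    (differentiable_adR Λ h2 h3)).add (differentiable_adR Λ h2 h4)).add (differentiable_adR Λ h3 h4)

/-- One cubic density of the extended field is differentiable in the field. [folklore] -/
theorem differentiable_cub (μ ν : Fin d) (x : Site d) :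
    Differentiable ℂ fun A : ↥Λ → 𝔸 => cub w τ η U₀ (ext Λ A) μ ν x := by
  unfold cub
  exact (τ.differentiable.comp ((differentiable_plaqCovDeriv Λ η U₀ μ ν x).mul
    (differentiable_brk Λ U₀ μ ν x))).const_mul w

/-- **THE FINITE-VOLUME CUBIC COMMUTATOR FUNCTIONAL IS ℂ-DIFFERENTIABLE** (a continuous cubic polynomial in the bond
variables). [folklore] -/
theorem differentiable_cubT : Differentiable ℂ (cubT Λ Pl w τ η U₀) := by
  have h : cubT Λ Pl w τ η U₀ = fun A => ∑ p ∈ Pl, cub w τ η U₀ (ext Λ A) p.1 p.2.1 p.2.2 := rfl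
  rw [h]
  exact Differentiable.fun_sum fun p _ => differentiable_cub Λ w τ η U₀ p.1 p.2.1 p.2.2

/-! ## §3 The bond-local gradient IS the first variation in the single-bond direction -/

/-- Along the line `t ↦ A + tH` the functional has derivative `Σ_p dcub(ext A)[ext H](p)` at `t = 0` (leaf-05's
`hasDerivAt_sum_cub` at `B = ext A`, direction `ext H`). [folklore] -/
theorem hasDerivAt_cubT_line (A H : ↥Λ → 𝔸) :
    HasDerivAt (fun t : ℂ => cubT Λ Pl w τ η U₀ (A + t • H))
      (∑ p ∈ Pl, dcub w τ η U₀ (ext Λ A) (ext Λ H) p.1 p.2.1 p.2.2) 0 := by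
  have h : (fun t : ℂ => cubT Λ Pl w τ η U₀ (A + t • H)) =
      fun t : ℂ => ∑ p ∈ Pl, cub w τ η U₀ (ext Λ A + t • ext Λ H) p.1 p.2.1 p.2.2 := by
    funext t
    rw [cubT_apply, ext_add_smul]
  rw [h]
  exact hasDerivAt_sum_cub Pl w τ η U₀ (ext Λ A) (ext Λ H)

/-- The Fréchet derivative applied to a direction is the line derivative. [folklore] -/
theorem fderiv_cubT_apply (A H : ↥Λ → 𝔸) :
    fderiv ℂ (cubT Λ Pl w τ η U₀) A H = ∑ p ∈ Pl, dcub w τ η U₀ (ext Λ A) (ext Λ H) p.1 p.2.1 p.2.2 := by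
  -- the line derivative computed by the chain rule …
  have h1 : HasDerivAt (fun t : ℂ => A + t • H) ((1 : ℂ) • H) 0 := ((hasDerivAt_id (0 : ℂ)).smul_const H).const_add A
  have h2 : HasFDerivAt (cubT Λ Pl w τ η U₀) (fderiv ℂ (cubT Λ Pl w τ η U₀) A) (A + (0 : ℂ) • H) := by
    rw [zero_smul, add_zero]
    exact ((differentiable_cubT Λ Pl w τ η U₀) A).hasFDerivAt
  have hline : HasDerivAt (fun t : ℂ => cubT Λ Pl w τ η U₀ (A + t • H)) (fderiv ℂ (cubT Λ Pl w τ η U₀) A H) 0 := by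
    simpa [Function.comp_def, one_smul] using h2.comp_hasDerivAt (0 : ℂ) h1
  -- … equals leaf-05's first variation, by uniqueness of the derivative
  exact hline.unique (hasDerivAt_cubT_line Λ Pl w τ η U₀ A H)

/-- **S62's BOND-LOCAL GRADIENT OF THE CUBIC COMMUTATOR FUNCTIONAL = leaf-05's FIRST VARIATION IN THE SINGLE-BOND
DIRECTION**: `locGrad (cubT …) A b X = Σ_{p∈Pl} dcub w τ η U₀ (ext Λ A) (bump b.1.1 b.1.2 X) p`.  (B11 (90)∕(93): the
object whose bound «O(1)|∇A′||A′|» is S65 f3's — locator only.) [folklore] -/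
theorem locGrad_cubT_apply (A : ↥Λ → 𝔸) (b : ↥Λ) (X : 𝔸) :
    locGrad (cubT Λ Pl w τ η U₀) A b X =
      ∑ p ∈ Pl, dcub w τ η U₀ (ext Λ A) (bump b.1.1 b.1.2 X) p.1 p.2.1 p.2.2 := by
  rw [locGrad_apply_apply, fderiv_cubT_apply, ext_single]

/-- Hence a bound on leaf-05's first variation in every single-bond direction IS a bound on the operator norm of the
bond-local gradient: if `|Σ_p dcub(ext A)[bump_b X](p)| ≤ M·‖X‖` for all `X`, then `‖locGrad (cubT …) A b‖ ≤ M`.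
[folklore] -/
theorem norm_locGrad_cubT_le (A : ↥Λ → 𝔸) (b : ↥Λ) {M : ℝ} (hM : 0 ≤ M)
    (h : ∀ X : 𝔸, ‖∑ p ∈ Pl, dcub w τ η U₀ (ext Λ A) (bump b.1.1 b.1.2 X) p.1 p.2.1 p.2.2‖ ≤ M * ‖X‖) :
    ‖locGrad (cubT Λ Pl w τ η U₀) A b‖ ≤ M := by
  refine ContinuousLinearMap.opNorm_le_bound _ hM fun X => ?_
  rw [locGrad_cubT_apply]
  exact h X

end Functional

end Summit.QuantumFields.BalabanUV.T4Continuum.ShellMeasureCommutatorLocGrad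

end
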